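import Summits.BirchSwinnertonDyer.BirchSwinnertonDyer.Theorems.AlignedTransportAtTwoMainConjectureOfRankZeroBSDAtTwoTwistReading
import HarnessLib

/-!
# Route `AlignedTransportAtTwo`, crux C2 `MainConjectureOfRankZeroBSDAtTwo` (stmt-BirchSwinnertonDyer-22298):
# THE TWIST READING, BOUNDS — `corank_{ℤ₂} Sel_{2^∞}(W⁽²⁾/ℚ) ≤ 2·ord₂ #Ẽ(𝔽₂)` at unit central symbol (`≤ 2` for `a₂ = +1`, `≤ 4` for `a₂ = −1`, `≤ 3` on the
# `a₂ = −1` road); three points on the twist force `ord_{T=−2} L₂(W,T) = 3`; and «`corank Sel_{2^∞}(W⁽²⁾/ℚ) = ord_{T=−2} L₂`» ⟹ the main conjecture HOLDS AT THE PRIME `T+2`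

HONEST FRAMING (cell `bsd-f1-sign2`, WIDTH-5 attached prover seat `bsd-line-att-p5` gen 38 on line `birth` of the lead `bsd-line-att-p2`;
`--supports` stmt-BirchSwinnertonDyer-22298, closes nothing; BSD is NOT proved by any of this; the crux C2, its verdict «blocked-on
`Rank1Residual.GreenbergMuConjectureIrreducible`» and every registered stub are untouched). THEOREMS ONLY — no `def`, no instance, no named fact, no `sorry`.
PRINT binder: `h17` = Kato 17.4 (1)(2) AT `2` only. Sequel of `…TwistReading.lean` (`W₂` is ANY `ℚ`-model of `W⁽²⁾`, `V • W₂ = W^{(2)}`).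

* §1 ★★ `selmerCorank_twist_le_two_of_frobeniusTrace_eq_one` / `…le_four_of_frobeniusTrace_eq_neg_one` / `…le_four_of_unitSymbol`: for `W` globally minimal, GOOD ORDINARY
  at `2`, `f` its newform at level `N_W` with UNIT CENTRAL SYMBOL `‖[0]⁺_f‖₂ = 1` (so `r_an(W) = 0` and `L(W,1)/Ω⁺` is a `2`-adic unit up to the MTT normalisation):
  **`rank W⁽²⁾(ℚ) ≤ corank_{ℤ₂} Sel_{2^∞}(W⁽²⁾/ℚ) ≤ 2·ord₂ #Ẽ(𝔽₂)`**, i.e. `≤ 2` if `a₂ = +1` and `≤ 4` if `a₂ = −1` (`ord₋₂ L₂ ≤ 2·ord₂ #Ẽ(𝔽₂)`, g33, by the weight of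
  `(T+2)^n` at `T = 0` against `‖L₂(W,0)‖₂ = ‖#Ẽ(𝔽₂)‖₂²`); ★ `selmerCorank_twist_le_three_of_road_of_frobeniusTrace_eq_neg_one`: **`≤ 3`** on the `a₂ = −1` road (`ord₋₂ ∈ {1,3}`).
* §2 ★ `three_le_orderAtNegTwo_of_selmerCorank_twist` — **three independent `2^∞`-Selmer directions of the twist force `ord_{T=−2} L₂(W,T) ≥ 3`** (any good-ordinary `W`, PRINT `h17`);
  on the `a₂ = −1` road `orderAtNegTwo_eq_three_of_road_of_selmerCorank_twist`: **`= 3` exactly** — a road curve whose twist by `2` has rank `3` sits on the two-bit row of the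
  CONSERVATION memo, never on the `ord₋₂ = 1` rows (1187, 1259, 3523, 4307 have `ord₋₂ = 1`: their twists by `2` have rank `≤ 1`).
* §3 ★★ `hasOrderAtNegTwo_charGen_of_selmerCorank_twist_eq` — **«`corank_{ℤ₂} Sel_{2^∞}(W⁽²⁾/ℚ) = ord_{T=−2} L₂(W,T)`» ⟹ `ord_{T=−2} f_X = ord_{T=−2} L₂`**: the main conjecture
  holds AT THE PRIME `T+2` of `Λ` (equal `(T+2)`-lengths of `char X` and `(L₂)`) as soon as the twist's Selmer corank saturates Kato's bound — on the `a₂ = +1` road this is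
  `corank = 1` (automatic with the `2`-parity theorem, `…TwistReading` §3), on the `ord₋₂ = 3` row it is `corank = 3`.

References: K. Kato, Astérisque 295 (2004), Thm. 17.4 [Kato2004Asterisque]; R. Greenberg, LNM 1716 (1999), §3 Lemma 3.1, §4 p. 107, §5 p. 181 [GreenbergLNM1716];
B. Mazur, J. Tate, J. Teitelbaum, Invent. Math. 84 (1986) §I.14 [MazurTateTeitelbaum1986Invent]; K. Rubin, *Euler Systems*, Ch. VI §1–§2 [Rubin2000].
-/

set_option linter.dupNamespace false
set_option autoImplicit false

noncomputable section

open scoped Classical MatrixGroups ModularForm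

namespace Summit.BirchSwinnertonDyer.BirchSwinnertonDyer.Theorems.AlignedTransportAtTwoTwistReadingBounds

open PowerSeries CongruenceSubgroup WeierstrassCurve Literature.NumberTheory.EllipticCurves
  Literature.NumberTheory.EllipticCurves.ModularForms
  Literature.NumberTheory.EllipticCurves.Rank1Residual
  Literature.NumberTheory.EllipticCurves.Rank1Residual.Typed
  Literature.NumberTheory.EllipticCurves.Greenberg1999
  Literature.NumberTheory.EllipticCurves.Module
  Literature.NumberTheory.EllipticCurves.IwasawaAlgebra
  Literature.NumberTheory.EllipticCurves.PadicIntSeries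
  Summit.BirchSwinnertonDyer.Rank1Residual
  Summit.BirchSwinnertonDyer.Rank1Residual.X1.MuLambda
  Summit.BirchSwinnertonDyer.Rank1Residual.X1.MuPart
  Summit.BirchSwinnertonDyer.Rank1Residual.X1.CyclotomicZeros
  Summit.BirchSwinnertonDyer.Rank1Residual.F1Sign2
  Summit.BirchSwinnertonDyer.Rank1Residual.Iwasawa
  Summit.BirchSwinnertonDyer.BirchSwinnertonDyer.Theorems.Rank1ResidualX1Defs
  Summit.BirchSwinnertonDyer.BirchSwinnertonDyer.Theorems.AlignedTransportAtTwoSeed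
  Summit.BirchSwinnertonDyer.BirchSwinnertonDyer.Theorems.AlignedTransportAtTwoSeedLambdaCell
  Summit.BirchSwinnertonDyer.BirchSwinnertonDyer.Theorems.AlignedTransportAtTwoEisensteinRigidity
  Summit.BirchSwinnertonDyer.BirchSwinnertonDyer.Theorems.AlignedTransportAtTwoEisensteinRigidityRoad
  Summit.BirchSwinnertonDyer.BirchSwinnertonDyer.Theorems.AlignedTransportAtTwoEisensteinRigidityFixedPoints
  Summit.BirchSwinnertonDyer.BirchSwinnertonDyer.Theorems.AlignedTransportAtTwoLayerOneRankBound
  Summit.BirchSwinnertonDyer.BirchSwinnertonDyer.Theorems.AlignedTransportAtTwoTwoFixedPoints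
  Summit.BirchSwinnertonDyer.BirchSwinnertonDyer.Theorems.AlignedTransportAtTwoRoadSecondFixedPoint
  Summit.BirchSwinnertonDyer.BirchSwinnertonDyer.Theorems.AddSelmerTwistTwo
  Summit.BirchSwinnertonDyer.BirchSwinnertonDyer.Theorems.AlignedTransportAtTwoTwistReading

variable (W : WeierstrassCurve ℚ) [W.IsElliptic] [W.IsGloballyMinimal] (W₂ : WeierstrassCurve ℚ) [W₂.IsElliptic]
  {V : VariableChange ℚ} (hV : V • W₂ = W.quadraticTwist 2)

/-! ## §1 `corank_{ℤ₂} Sel_{2^∞}(W⁽²⁾/ℚ) ≤ 2·ord₂ #Ẽ(𝔽₂)` at unit central symbol -/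

include hV in
/-- ★★ **`a₂ = +1`, unit central symbol: `corank_{ℤ₂} Sel_{2^∞}(W⁽²⁾/ℚ) ≤ 2` and `rank W⁽²⁾(ℚ) ≤ 2`.** `W` globally minimal, good ordinary at `2` with `a₂ = +1`, `f` its
newform at level `N_W` with `‖[0]⁺_f‖₂ = 1`, `G` the integral lift of `L₂(f,α)`; PRINT `h17`. (`ord₋₂ L₂ ≤ 2` by g33 `orderAtNegTwo_le_two_of_frobeniusTrace_eq_one`, then
`…TwistReading` §3.) No road hypothesis (`Δ`, Tamagawa) is needed. [cite: Kato2004Asterisque, Thm. 17.4 (1)(2) (p. 273)] [cite: MazurTateTeitelbaum1986Invent, §I.14]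
[cite: GreenbergLNM1716, §3 Lemma 3.1, §4 p. 107] -/
theorem selmerCorank_twist_le_two_of_frobeniusTrace_eq_one [NeZero (W.conductorNorm ℤ)] {f : CuspForm (Gamma0 (W.conductorNorm ℤ)) 2}
    (h17 : kato_divisibility_allPrimes W 2 (f := f)) (hord : IsOrdinaryAt W 2) (hf : IsNewformOf W f) (ha : W.frobeniusTrace 2 = 1)
    {G : IwasawaAlgebra 2} (hG : iwasawaToPowerSeries 2 G = padicLFunction f (unitRoot W 2 : ℚ_[2]))
    (hsym : ‖(ratPlusSymbol f 0 : ℚ_[2])‖ = 1) : W₂.selmerCorank 2 ≤ 2 ∧ W₂.mordellWeilRank ≤ 2 := by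
  have hG0 : G ≠ 0 := by
    intro h0
    rw [h0, map_zero] at hG
    exact padicLFunction_unitRoot_ne_zero hord hf hG.symm
  obtain ⟨n, hn⟩ := exists_hasOrderAtNegTwo hG0
  have hn2 : n ≤ 2 := orderAtNegTwo_le_two_of_frobeniusTrace_eq_one hord hf ha hG hsym hn.1
  obtain ⟨h1, h2⟩ := selmerCorank_twist_le_orderAtNegTwo W W₂ hV h17 hord hf hG hn
  exact ⟨h1.trans hn2, h2.trans hn2⟩

include hV in
/-- ★★ **`a₂ = −1`, unit central symbol: `corank_{ℤ₂} Sel_{2^∞}(W⁽²⁾/ℚ) ≤ 4` and `rank W⁽²⁾(ℚ) ≤ 4`** (`#Ẽ(𝔽₂) = 4`, `ord₋₂ L₂ ≤ 4`). PRINT `h17`.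
[cite: Kato2004Asterisque, Thm. 17.4 (1)(2) (p. 273)] [cite: MazurTateTeitelbaum1986Invent, §I.14] [cite: GreenbergLNM1716, §3 Lemma 3.1, §4 p. 107] -/
theorem selmerCorank_twist_le_four_of_frobeniusTrace_eq_neg_one [NeZero (W.conductorNorm ℤ)] {f : CuspForm (Gamma0 (W.conductorNorm ℤ)) 2}
    (h17 : kato_divisibility_allPrimes W 2 (f := f)) (hord : IsOrdinaryAt W 2) (hf : IsNewformOf W f) (ha : W.frobeniusTrace 2 = -1)
    {G : IwasawaAlgebra 2} (hG : iwasawaToPowerSeries 2 G = padicLFunction f (unitRoot W 2 : ℚ_[2]))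
    (hsym : ‖(ratPlusSymbol f 0 : ℚ_[2])‖ = 1) : W₂.selmerCorank 2 ≤ 4 ∧ W₂.mordellWeilRank ≤ 4 := by
  have hG0 : G ≠ 0 := by
    intro h0
    rw [h0, map_zero] at hG
    exact padicLFunction_unitRoot_ne_zero hord hf hG.symm
  obtain ⟨n, hn⟩ := exists_hasOrderAtNegTwo hG0
  have hn4 : n ≤ 4 := orderAtNegTwo_le_four_of_frobeniusTrace_eq_neg_one hord hf ha hG hsym hn.1
  obtain ⟨h1, h2⟩ := selmerCorank_twist_le_orderAtNegTwo W W₂ hV h17 hord hf hG hn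
  exact ⟨h1.trans hn4, h2.trans hn4⟩

include hV in
/-- ★★ **EVERY good-ordinary `W` at `2` with unit central symbol: `rank W⁽²⁾(ℚ) ≤ corank_{ℤ₂} Sel_{2^∞}(W⁽²⁾/ℚ) ≤ 4`** (`a₂` is odd with `a₂² ≤ 8`, so `a₂ = ±1`; the two cases above).
In words: if `(1−α⁻¹)²·L(W,1)/Ω⁺_W` is a `2`-adic unit up to `#Ẽ(𝔽₂)²`, the quadratic twist of `W` by `2` has at most four independent rational points. PRINT `h17`.
[cite: Kato2004Asterisque, Thm. 17.4 (1)(2) (p. 273)] [cite: MazurTateTeitelbaum1986Invent, §I.14] [cite: SilvermanAEC2009, V Ex. 5.10(a)] -/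
theorem selmerCorank_twist_le_four_of_unitSymbol [NeZero (W.conductorNorm ℤ)] {f : CuspForm (Gamma0 (W.conductorNorm ℤ)) 2}
    (h17 : kato_divisibility_allPrimes W 2 (f := f)) (hord : IsOrdinaryAt W 2) (hf : IsNewformOf W f)
    {G : IwasawaAlgebra 2} (hG : iwasawaToPowerSeries 2 G = padicLFunction f (unitRoot W 2 : ℚ_[2]))
    (hsym : ‖(ratPlusSymbol f 0 : ℚ_[2])‖ = 1) : W₂.selmerCorank 2 ≤ 4 ∧ W₂.mordellWeilRank ≤ 4 := by
  -- `a₂ = ±1`: odd (ordinary) and `a₂² ≤ 8` (Hasse)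
  have ha₂ : W.frobeniusTrace 2 = 1 ∨ W.frobeniusTrace 2 = -1 := by
    have hH : W.frobeniusTrace 2 ^ 2 ≤ 8 := by
      have h := W.frobeniusTrace_sq_le_four_mul 2 hord.1
      push_cast at h
      linarith
    have hodd : ¬ (2 : ℤ) ∣ W.frobeniusTrace 2 := by exact_mod_cast hord.2
    have hb : -2 ≤ W.frobeniusTrace 2 ∧ W.frobeniusTrace 2 ≤ 2 := by
      constructor <;> nlinarith [hH, sq_nonneg (W.frobeniusTrace 2 + 3), sq_nonneg (W.frobeniusTrace 2 - 3)]
    omega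
  rcases ha₂ with ha | ha
  · obtain ⟨h1, h2⟩ := selmerCorank_twist_le_two_of_frobeniusTrace_eq_one W W₂ hV h17 hord hf ha hG hsym
    exact ⟨h1.trans (by norm_num), h2.trans (by norm_num)⟩
  · exact selmerCorank_twist_le_four_of_frobeniusTrace_eq_neg_one W W₂ hV h17 hord hf ha hG hsym

include hV in
/-- ★ **The `a₂ = −1` road: `corank_{ℤ₂} Sel_{2^∞}(W⁽²⁾/ℚ) ≤ 3`, `rank W⁽²⁾(ℚ) ≤ 3`** (`∏ c_v` odd, `Δ_min ≡ 3, 5 (mod 8)`, `r_an = 0`, unit central symbol: `ord₋₂ L₂ ∈ {1, 3}`, g33).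
PRINT `h17`. With the `2`-parity theorem and `w(W⁽²⁾) = −1` (g32) the corank is `1` or `3`. [cite: Kato2004Asterisque, Thm. 17.4 (1)(2) (p. 273)] [cite: GreenbergLNM1716, §5 p. 181] -/
theorem selmerCorank_twist_le_three_of_road_of_frobeniusTrace_eq_neg_one [NeZero (W.conductorNorm ℤ)]
    {f : CuspForm (Gamma0 (W.conductorNorm ℤ)) 2}
    (h17 : kato_divisibility_allPrimes W 2 (f := f)) (hord : IsOrdinaryAt W 2) (hf : IsNewformOf W f) (ha : W.frobeniusTrace 2 = -1)
    (hodd : Odd W.tamagawaProduct) (hΔ : minimalDiscriminantInt W % 8 = 3 ∨ minimalDiscriminantInt W % 8 = 5) (hr : W.analyticRank = 0)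
    {G : IwasawaAlgebra 2} (hG : iwasawaToPowerSeries 2 G = padicLFunction f (unitRoot W 2 : ℚ_[2]))
    (hsym : ‖(ratPlusSymbol f 0 : ℚ_[2])‖ = 1) : W₂.selmerCorank 2 ≤ 3 ∧ W₂.mordellWeilRank ≤ 3 := by
  have hG0 : G ≠ 0 := by
    intro h0
    rw [h0, map_zero] at hG
    exact padicLFunction_unitRoot_ne_zero hord hf hG.symm
  obtain ⟨n, hn⟩ := exists_hasOrderAtNegTwo hG0
  have hn3 : n ≤ 3 := by
    rcases orderAtNegTwo_eq_one_or_three_of_road_of_frobeniusTrace_eq_neg_one hord hf ha hodd hΔ hr hG hsym hn with h | h <;> omega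
  obtain ⟨h1, h2⟩ := selmerCorank_twist_le_orderAtNegTwo W W₂ hV h17 hord hf hG hn
  exact ⟨h1.trans hn3, h2.trans hn3⟩

/-! ## §2 Three Selmer directions on the twist force a triple zero of `L₂(W,T)` at the order-`2` character -/

include hV in
/-- ★ **`corank_{ℤ₂} Sel_{2^∞}(W⁽²⁾/ℚ) ≥ 3 ⟹ ord_{T=−2} L₂(W,T) ≥ 3`** for every good-ordinary `W` at `2` (PRINT `h17`; contrapositive of `…TwistReading` §3): three independent
`2^∞`-Selmer directions (e.g. three independent rational points) on the quadratic twist by `2` force the `2`-adic `L`-function of `W` to vanish to order `≥ 3` at `χ₈`.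
[cite: Kato2004Asterisque, Thm. 17.4 (1)(2) (p. 273)] [cite: GreenbergLNM1716, §3 Lemma 3.1, §4 p. 107] -/
theorem three_le_orderAtNegTwo_of_selmerCorank_twist {N : ℕ} [NeZero N] {f : CuspForm (Gamma0 N) 2}
    (h17 : kato_divisibility_allPrimes W 2 (f := f)) (hord : IsOrdinaryAt W 2) (hf : IsNewformOf W f)
    {G : IwasawaAlgebra 2} (hG : iwasawaToPowerSeries 2 G = padicLFunction f (unitRoot W 2 : ℚ_[2])) {n : ℕ}
    (hn : HasOrderAtNegTwo G n) (hs : 3 ≤ W₂.selmerCorank 2) : 3 ≤ n :=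
  hs.trans (selmerCorank_twist_le_orderAtNegTwo W W₂ hV h17 hord hf hG hn).1

include hV in
/-- ★ **On the `a₂ = −1` road, `corank_{ℤ₂} Sel_{2^∞}(W⁽²⁾/ℚ) ≥ 3 ⟹ ord_{T=−2} L₂(W,T) = 3` EXACTLY** (`ord₋₂ ∈ {1, 3}` on the road, g33): such a curve sits on the two-bit row of the
CONSERVATION memo. PRINT `h17`. [cite: Kato2004Asterisque, Thm. 17.4 (1)(2) (p. 273)] [cite: GreenbergLNM1716, §5 p. 181] -/
theorem orderAtNegTwo_eq_three_of_road_of_selmerCorank_twist [NeZero (W.conductorNorm ℤ)] {f : CuspForm (Gamma0 (W.conductorNorm ℤ)) 2}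
    (h17 : kato_divisibility_allPrimes W 2 (f := f)) (hord : IsOrdinaryAt W 2) (hf : IsNewformOf W f) (ha : W.frobeniusTrace 2 = -1)
    (hodd : Odd W.tamagawaProduct) (hΔ : minimalDiscriminantInt W % 8 = 3 ∨ minimalDiscriminantInt W % 8 = 5) (hr : W.analyticRank = 0)
    {G : IwasawaAlgebra 2} (hG : iwasawaToPowerSeries 2 G = padicLFunction f (unitRoot W 2 : ℚ_[2]))
    (hsym : ‖(ratPlusSymbol f 0 : ℚ_[2])‖ = 1) {n : ℕ} (hn : HasOrderAtNegTwo G n) (hs : 3 ≤ W₂.selmerCorank 2) : n = 3 := by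
  have h3 := three_le_orderAtNegTwo_of_selmerCorank_twist W W₂ hV h17 hord hf hG hn hs
  rcases orderAtNegTwo_eq_one_or_three_of_road_of_frobeniusTrace_eq_neg_one hord hf ha hodd hΔ hr hG hsym hn with h | h <;> omega

/-! ## §3 Saturation: «`corank Sel_{2^∞}(W⁽²⁾/ℚ) = ord_{T=−2} L₂`» ⟹ the main conjecture holds at the prime `T + 2` -/

include hV in
/-- ★★ **THE MAIN CONJECTURE AT THE PRIME `T+2` FROM THE TWIST.** `W` globally minimal, good ordinary at `2`, `f` a newform of `W` with PRINT `h17`, `G` the integral lift of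
`L₂(f,α)` with `ord_{T=−2} G = n`, and `W₂` any `ℚ`-model of `W⁽²⁾` with **`corank_{ℤ₂} Sel_{2^∞}(W₂/ℚ) ≥ n`**. Then at every cyclotomic dual datum and every generator `f_X` of
`char_Λ X(W/ℚ_∞)`: **`ord_{T=−2} f_X = n`** (`(T+2)^n ∣ f_X` by `…TwistReading` §2, `(T+2)^{n+1} ∤ f_X` by Kato) — the `(T+2)`-primary lengths of `char X` and of `(L₂)` AGREE.
[cite: Kato2004Asterisque, Thm. 17.4 (1)(2) (p. 273)] [cite: GreenbergLNM1716, §3 Lemma 3.1, §4 p. 107, §5 p. 181] -/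
theorem hasOrderAtNegTwo_charGen_of_le_selmerCorank_twist {N : ℕ} [NeZero N] {f : CuspForm (Gamma0 N) 2}
    (h17 : kato_divisibility_allPrimes W 2 (f := f)) (hord : IsOrdinaryAt W 2) (hf : IsNewformOf W f)
    {G : IwasawaAlgebra 2} (hG : iwasawaToPowerSeries 2 G = padicLFunction f (unitRoot W 2 : ℚ_[2])) {n : ℕ}
    (hn : HasOrderAtNegTwo G n) (hs : n ≤ W₂.selmerCorank 2)
    {κ : ZpExtension ℚ 2} {γ : Field.absoluteGaloisGroup ℚ} (hκ : κ.IsCyclotomic) (hγ : κ.IsTopGenerator γ)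
    (hγ' : IsCyclotomicVariable 2 γ) (D : W.SelmerDualData κ γ) {fX : IwasawaAlgebra 2} (hchar : D.charIdeal = Ideal.span {fX}) :
    HasOrderAtNegTwo fX n := by
  obtain ⟨hD, -⟩ := isTorsion_and_exists_charGen_mul_eq_C_pow_mul_of_kato W h17 hκ hγ hγ' hord hf D hchar hG
  exact ⟨(pow_dvd_pow _ hs).trans (X_add_C_two_pow_selmerCorank_twist_dvd_charGen κ hκ hγ W W₂ hV D hD hchar),
    not_X_add_C_two_pow_succ_dvd_charGen W h17 hord hf hG hn hκ hγ hγ' D hchar⟩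

include hV in
/-- ★ **Mordell–Weil form**: `rank W⁽²⁾(ℚ) ≥ ord_{T=−2} L₂(W,T) = n ⟹ ord_{T=−2} f_X = n` at every datum. [cite: Kato2004Asterisque, Thm. 17.4 (1)(2) (p. 273)]
[cite: GreenbergLNM1716, Thm. 1.9, §4 p. 107] -/
theorem hasOrderAtNegTwo_charGen_of_le_mordellWeilRank_twist {N : ℕ} [NeZero N] {f : CuspForm (Gamma0 N) 2}
    (h17 : kato_divisibility_allPrimes W 2 (f := f)) (hord : IsOrdinaryAt W 2) (hf : IsNewformOf W f)
    {G : IwasawaAlgebra 2} (hG : iwasawaToPowerSeries 2 G = padicLFunction f (unitRoot W 2 : ℚ_[2])) {n : ℕ}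
    (hn : HasOrderAtNegTwo G n) (hs : n ≤ W₂.mordellWeilRank)
    {κ : ZpExtension ℚ 2} {γ : Field.absoluteGaloisGroup ℚ} (hκ : κ.IsCyclotomic) (hγ : κ.IsTopGenerator γ)
    (hγ' : IsCyclotomicVariable 2 γ) (D : W.SelmerDualData κ γ) {fX : IwasawaAlgebra 2} (hchar : D.charIdeal = Ideal.span {fX}) :
    HasOrderAtNegTwo fX n := by
  obtain ⟨hD, -⟩ := isTorsion_and_exists_charGen_mul_eq_C_pow_mul_of_kato W h17 hκ hγ hγ' hord hf D hchar hG
  exact ⟨(pow_dvd_pow _ hs).trans (X_add_C_two_pow_mordellWeilRank_twist_dvd_charGen κ hκ hγ W W₂ hV D hD hchar),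
    not_X_add_C_two_pow_succ_dvd_charGen W h17 hord hf hG hn hκ hγ hγ' D hchar⟩

include hV in
/-- ★ **On the `a₂ = +1` road the `(T+2)`-parts agree as soon as the twist has ONE point of infinite order** (`rank W⁽²⁾(ℚ) ≥ 1`; there `ord₋₂ L₂ = 1`, g33): `ord₋₂ f_X = 1`,
PRINT `h17` only — the Matsuno-free form of g34 `hasOrderAtNegTwo_charGen_one_of_road` (which used Prop. 6.4 instead of a point). [cite: Kato2004Asterisque, Thm. 17.4 (1)(2) (p. 273)]
[cite: GreenbergLNM1716, Thm. 1.9, §4 p. 107, §5 p. 181] -/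
theorem hasOrderAtNegTwo_charGen_one_of_road_of_mordellWeilRank_twist_pos [NeZero (W.conductorNorm ℤ)]
    {f : CuspForm (Gamma0 (W.conductorNorm ℤ)) 2}
    (h17 : kato_divisibility_allPrimes W 2 (f := f)) (hord : IsOrdinaryAt W 2) (hf : IsNewformOf W f) (ha : W.frobeniusTrace 2 = 1)
    (hodd : Odd W.tamagawaProduct) (hΔ : minimalDiscriminantInt W % 8 = 3 ∨ minimalDiscriminantInt W % 8 = 5) (hr : W.analyticRank = 0)
    {G : IwasawaAlgebra 2} (hG : iwasawaToPowerSeries 2 G = padicLFunction f (unitRoot W 2 : ℚ_[2]))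
    (hsym : ‖(ratPlusSymbol f 0 : ℚ_[2])‖ = 1) (hs : 1 ≤ W₂.mordellWeilRank)
    {κ : ZpExtension ℚ 2} {γ : Field.absoluteGaloisGroup ℚ} (hκ : κ.IsCyclotomic) (hγ : κ.IsTopGenerator γ)
    (hγ' : IsCyclotomicVariable 2 γ) (D : W.SelmerDualData κ γ) {fX : IwasawaAlgebra 2} (hchar : D.charIdeal = Ideal.span {fX}) :
    HasOrderAtNegTwo fX 1 ∧ HasOrderAtNegTwo G 1 := by
  have hG0 : G ≠ 0 := by
    intro h0
    rw [h0, map_zero] at hG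
    exact padicLFunction_unitRoot_ne_zero hord hf hG.symm
  obtain ⟨n, hn⟩ := exists_hasOrderAtNegTwo hG0
  have hn1 : n = 1 := orderAtNegTwo_eq_one_of_road_of_frobeniusTrace_eq_one hord hf ha hodd hΔ hr hG hsym hn
  subst hn1
  exact ⟨hasOrderAtNegTwo_charGen_of_le_mordellWeilRank_twist W W₂ hV h17 hord hf hG hn hs hκ hγ hγ' D hchar, hn⟩

end Summit.BirchSwinnertonDyer.BirchSwinnertonDyer.Theorems.AlignedTransportAtTwoTwistReadingBounds

end
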